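import Literature.Analysis.FluidPDE.TaoY6Cutoffs
import Literature.Analysis.FluidPDE.TaoY6AnnulusChain
import HarnessLib

/-!
# The dyadic shells and the core of the annulus are Whitney pieces

Analysis/FluidPDE support file for the discharge of the named fact
`Literature.Analysis.FluidPDE.tao2011_nonlinearEstimate` (Tao 2011, §10, proof of Thm. 10.1,
estimate of `Y₆`, arXiv:1108.1165 p. 32, Whitney decomposition "with radius
`rᵢ = (1/100) min(dist(xᵢ,∂Ω), c^{0.1}δ⁻²)`. In particular, we have `η ∼ c^{-0.1}δ²rᵢ` on
`B(xᵢ,10rᵢ)`", in the annulus of Remark 10.6). For the cutoff `η = annularRamp k a b |· − x₀|`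
(`0 < a`, `a + 2/k < b`) we verify that the smooth dyadic shell cutoffs of `FluidPDE/TaoY6Cutoffs`,

* inner shells `χ = shellCutoff (|· − x₀| − a) σ`, outer shells `χ = shellCutoff (b − |· − x₀|) σ`
  (`σ = 2⁻ⁿ/k ≤ 1/k`), with scale `r = σ/128` and level `θ = kσ/4`, and
* the core `χ = coreCutoff x₀ k a b`, with `r = 1/(64k)`, `θ = 1/2`,

satisfy the hypotheses of the piece estimate `FluidPDE/TaoY6Piece`: `k r = θ/32`, `θ ≤ η ≤ 4θ`
on `supp χ` (Tao's (10.20) `η ∼ kr`), the gradient bound `θ ‖Dχ‖ ≤ L_ψ k`, compact support in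
`B̄(x₀, b)`, and the Whitney-scale mass bound `∫_{B(y,5r)} ‖f‖² ≤ 64·10⁶ r Λ`,
`Λ = k ∫‖f‖²η + k⁻¹∫‖Df‖²η`, at every `y ∈ supp χ` (from `FluidPDE/TaoY6AnnulusChain`).

## References

* T. Tao, arXiv:1108.1165 (`Tao2011`), §10, proof of Thm. 10.1, p. 32 ((10.20)) and Remark 10.6.
-/

noncomputable section

open MeasureTheory Set Filter Metric Function
open scoped NNReal

namespace Literature.Analysis.FluidPDE.TaoY6

variable {F : Type*} [NormedAddCommGroup F] [NormedSpace ℝ F] [CompleteSpace F]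
variable {x₀ : EuclideanSpace ℝ (Fin 3)} {k a b : ℝ}

/-! ### Shells: the generic verification for a depth coordinate `φ` -/

section Shell

variable {φ : EuclideanSpace ℝ (Fin 3) → ℝ} {σ : ℝ}

/-- On the support of a shell cutoff whose depth coordinate *is* the depth, `η = k φ` and
`θ ≤ η ≤ 4θ` with `θ = kσ/4` (`σ ≤ 1/k`). [cite: Tao2011, §10, proof of Thm. 10.1 ((10.20))] -/
theorem annularRamp_mem_Icc_of_mem_tsupport_shellCutoff (hk : 0 < k) (hσ : 0 < σ) (hσk : σ ≤ k⁻¹)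
    (hφ : Continuous φ)
    (hdepth : ∀ y, σ / 4 ≤ φ y → φ y ≤ σ → annDepth x₀ a b y = φ y)
    {y : EuclideanSpace ℝ (Fin 3)} (hy : y ∈ tsupport (shellCutoff φ σ)) :
    k * σ / 4 ≤ annularRamp k a b ‖y - x₀‖ ∧ annularRamp k a b ‖y - x₀‖ ≤ 4 * (k * σ / 4) := by
  obtain ⟨h1, h2⟩ := le_and_le_of_mem_tsupport_shellCutoff hσ hφ hy
  have hd := hdepth y h1 h2
  have hd0 : 0 ≤ annDepth x₀ a b y := by rw [hd]; linarith
  have hd1 : annDepth x₀ a b y ≤ k⁻¹ := by rw [hd]; linarith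
  rw [annularRamp_norm_sub_eq_mul_annDepth hk hd0 hd1, hd]
  constructor <;> nlinarith

/-- **The Whitney-scale mass bound on a shell**: at every point of the support of a shell
cutoff at scale `σ` (depth between `σ/4` and `σ`), with `r = σ/128`,
`∫_{B(y,5r)} ‖f‖² ≤ 64·10⁶ · r · (k ∫‖f‖²η + k⁻¹ ∫‖Df‖²η)`. [cite: Tao2011, §10, proof of Thm. 10.1 (pp. 32–33, (10.23) and the chaining)] -/
theorem setIntegral_ball_sq_norm_le_of_mem_tsupport_shellCutoff {f : EuclideanSpace ℝ (Fin 3) → F}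
    (hf : ContDiff ℝ 1 f) (hk : 0 < k) (ha : 0 < a) (hab : a + 2 * k⁻¹ < b) (hσ : 0 < σ)
    (hσk : σ ≤ k⁻¹) (hφ : Continuous φ)
    (hdepth : ∀ y, σ / 4 ≤ φ y → φ y ≤ σ → annDepth x₀ a b y = φ y)
    (hW : Integrable fun x => ‖f x‖ ^ 2 * annularRamp k a b ‖x - x₀‖)
    (hY : Integrable fun x => ‖fderiv ℝ f x‖ ^ 2 * annularRamp k a b ‖x - x₀‖)
    {y : EuclideanSpace ℝ (Fin 3)} (hy : y ∈ tsupport (shellCutoff φ σ)) :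
    ∫ x in ball y (5 * (σ / 128)), ‖f x‖ ^ 2 ≤
      64000000 * (σ / 128) * (k * (∫ x, ‖f x‖ ^ 2 * annularRamp k a b ‖x - x₀‖) +
        k⁻¹ * ∫ x, ‖fderiv ℝ f x‖ ^ 2 * annularRamp k a b ‖x - x₀‖) := by
  obtain ⟨h1, h2⟩ := le_and_le_of_mem_tsupport_shellCutoff hσ hφ hy
  have hd := hdepth y h1 h2
  have hdpos : 0 < annDepth x₀ a b y := by rw [hd]; linarith
  have hmin : min (annDepth x₀ a b y) k⁻¹ = φ y := by rw [hd, min_eq_left (h2.trans hσk)]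
  have hmass := setIntegral_ball_sq_norm_le_whitney hf hk ha hab hdpos hW hY
  rw [hmin] at hmass
  set Λ : ℝ := k * (∫ x, ‖f x‖ ^ 2 * annularRamp k a b ‖x - x₀‖) +
    k⁻¹ * ∫ x, ‖fderiv ℝ f x‖ ^ 2 * annularRamp k a b ‖x - x₀‖ with hΛ
  have hη0 : ∀ x : EuclideanSpace ℝ (Fin 3), 0 ≤ annularRamp k a b ‖x - x₀‖ := fun x =>
    annularRamp_nonneg _ _ _ _
  have hΛ0 : 0 ≤ Λ := add_nonneg (mul_nonneg hk.le (integral_nonneg fun x => mul_nonneg (sq_nonneg _)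
    (hη0 x))) (mul_nonneg (inv_nonneg.2 hk.le) (integral_nonneg fun x => mul_nonneg (sq_nonneg _)
    (hη0 x)))
  have hsub : ball y (5 * (σ / 128)) ⊆ ball y (φ y / 4) := ball_subset_ball (by linarith)
  calc ∫ x in ball y (5 * (σ / 128)), ‖f x‖ ^ 2 ≤ ∫ x in ball y (φ y / 4), ‖f x‖ ^ 2 :=
        setIntegral_mono_set (integrableOn_of_continuous_of_isBounded (hf.continuous.norm.pow 2)
          isBounded_ball) (Eventually.of_forall fun x => sq_nonneg _) (Eventually.of_forall hsub)
    _ ≤ 2000000 * (φ y / 4) * Λ := hmass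
    _ ≤ 2000000 * (σ / 4) * Λ := by gcongr
    _ = 64000000 * (σ / 128) * Λ := by ring

/-- The gradient bound of a shell cutoff at scale `σ` with level `θ = kσ/4` satisfies
`θ ‖Dχ‖ ≤ L_ψ k` (`L = 3 L_ψ/σ`). [folklore] -/
theorem level_mul_shellLip_le (hk : 0 < k) (hσ : 0 < σ) :
    k * σ / 4 * (3 / σ * (stepLip : ℝ)) ≤ stepLip * k := by
  have h : k * σ / 4 * (3 / σ * (stepLip : ℝ)) = 3 / 4 * (stepLip * k) := by field_simp
  rw [h]
  nlinarith [mul_nonneg stepLip.2 hk.le]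

/-- The depth coordinate of the **inner** shells is the depth: if `σ/4 ≤ |y − x₀| − a ≤ σ` with
`σ ≤ 1/k` and `a + 2/k < b` then `d(y) = |y − x₀| − a`. [folklore] -/
theorem annDepth_eq_inner (hk : 0 < k) (hab : a + 2 * k⁻¹ < b) (hσk : σ ≤ k⁻¹)
    (y : EuclideanSpace ℝ (Fin 3)) (_h1 : σ / 4 ≤ ‖y - x₀‖ - a) (h2 : ‖y - x₀‖ - a ≤ σ) :
    annDepth x₀ a b y = ‖y - x₀‖ - a := by
  rw [annDepth_def, min_eq_left]
  have : (0 : ℝ) < k⁻¹ := inv_pos.2 hk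
  linarith

/-- The depth coordinate of the **outer** shells is the depth: if `σ/4 ≤ b − |y − x₀| ≤ σ` with
`σ ≤ 1/k` and `a + 2/k < b` then `d(y) = b − |y − x₀|`. [folklore] -/
theorem annDepth_eq_outer (hk : 0 < k) (hab : a + 2 * k⁻¹ < b) (hσk : σ ≤ k⁻¹)
    (y : EuclideanSpace ℝ (Fin 3)) (_h1 : σ / 4 ≤ b - ‖y - x₀‖) (h2 : b - ‖y - x₀‖ ≤ σ) :
    annDepth x₀ a b y = b - ‖y - x₀‖ := by
  rw [annDepth_def, min_eq_right]
  have : (0 : ℝ) < k⁻¹ := inv_pos.2 hk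
  linarith

/-- The inner shells are supported in the closed ball `B̄(x₀, b)`. [folklore] -/
theorem tsupport_shellCutoff_inner_subset (hk : 0 < k) (hab : a + 2 * k⁻¹ < b) (hσ : 0 < σ)
    (hσk : σ ≤ k⁻¹) :
    tsupport (shellCutoff (fun y : EuclideanSpace ℝ (Fin 3) => ‖y - x₀‖ - a) σ) ⊆ closedBall x₀ b := by
  intro y hy
  have hφc : Continuous fun y : EuclideanSpace ℝ (Fin 3) => ‖y - x₀‖ - a :=
    (continuous_id.sub continuous_const).norm.sub continuous_const
  obtain ⟨-, h2⟩ := le_and_le_of_mem_tsupport_shellCutoff hσ hφc hy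
  rw [mem_closedBall, dist_eq_norm]
  have : (0 : ℝ) < k⁻¹ := inv_pos.2 hk
  linarith

/-- The outer shells are supported in the closed ball `B̄(x₀, b)`. [folklore] -/
theorem tsupport_shellCutoff_outer_subset (hσ : 0 < σ) :
    tsupport (shellCutoff (fun y : EuclideanSpace ℝ (Fin 3) => b - ‖y - x₀‖) σ) ⊆ closedBall x₀ b := by
  intro y hy
  have hφc : Continuous fun y : EuclideanSpace ℝ (Fin 3) => b - ‖y - x₀‖ :=
    continuous_const.sub (continuous_id.sub continuous_const).norm
  obtain ⟨h1, -⟩ := le_and_le_of_mem_tsupport_shellCutoff hσ hφc hy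
  rw [mem_closedBall, dist_eq_norm]
  linarith

/-- Both families of shells have compact support. [folklore] -/
theorem hasCompactSupport_shellCutoff_inner (hk : 0 < k) (hab : a + 2 * k⁻¹ < b) (hσ : 0 < σ)
    (hσk : σ ≤ k⁻¹) :
    HasCompactSupport (shellCutoff (fun y : EuclideanSpace ℝ (Fin 3) => ‖y - x₀‖ - a) σ) :=
  (isCompact_closedBall x₀ b).of_isClosed_subset (isClosed_tsupport _)
    (tsupport_shellCutoff_inner_subset hk hab hσ hσk)

/-- Both families of shells have compact support. [folklore] -/
theorem hasCompactSupport_shellCutoff_outer (hσ : 0 < σ) :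
    HasCompactSupport (shellCutoff (fun y : EuclideanSpace ℝ (Fin 3) => b - ‖y - x₀‖) σ) :=
  (isCompact_closedBall x₀ b).of_isClosed_subset (isClosed_tsupport _)
    (tsupport_shellCutoff_outer_subset hσ)

end Shell

/-! ### The core -/

section Core

/-- On the support of the core cutoff the depth is at least `1/(2k)`. [folklore] -/
theorem annDepth_ge_of_mem_tsupport_coreCutoff (hk : 0 < k) (hab : a + 2 / k ≤ b)
    {y : EuclideanSpace ℝ (Fin 3)} (hy : y ∈ tsupport (coreCutoff x₀ k a b)) :
    1 / (2 * k) ≤ annDepth x₀ a b y := by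
  have hcl : IsClosed {z : EuclideanSpace ℝ (Fin 3) | 1 / (2 * k) ≤ annDepth x₀ a b z} :=
    isClosed_le continuous_const (continuous_annDepth x₀ a b)
  have hsub : support (coreCutoff x₀ k a b) ⊆ {z | 1 / (2 * k) ≤ annDepth x₀ a b z} := by
    intro z hz
    obtain ⟨h1, h2⟩ := lt_and_lt_of_coreCutoff_ne_zero hk hab hz
    show 1 / (2 * k) ≤ annDepth x₀ a b z
    rw [annDepth_def, le_min_iff]
    exact ⟨h1.le, h2.le⟩
  exact closure_minimal hsub hcl hy

/-- On the support of the core cutoff, `1/2 ≤ η ≤ 4 · (1/2)`. [cite: Tao2011, §10, proof of Thm. 10.1 ((10.20), large balls: η ∼ 1)] -/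
theorem annularRamp_mem_Icc_of_mem_tsupport_coreCutoff (hk : 0 < k) (hab : a + 2 / k ≤ b)
    {y : EuclideanSpace ℝ (Fin 3)} (hy : y ∈ tsupport (coreCutoff x₀ k a b)) :
    (1 / 2 : ℝ) ≤ annularRamp k a b ‖y - x₀‖ ∧ annularRamp k a b ‖y - x₀‖ ≤ 4 * (1 / 2) := by
  have hd := annDepth_ge_of_mem_tsupport_coreCutoff hk hab hy
  have hd0 : 0 ≤ annDepth x₀ a b y := le_trans (by positivity) hd
  rw [annularRamp_norm_sub_eq_min hk.le hd0]
  constructor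
  · rw [le_min_iff]
    refine ⟨by norm_num, ?_⟩
    have : k * (1 / (2 * k)) = 1 / 2 := by field_simp
    nlinarith
  · exact (min_le_left _ _).trans (by norm_num)

/-- **The Whitney-scale mass bound on the core**: at every point of the support of the core
cutoff, with `r = 1/(64k)`, `∫_{B(y,5r)} ‖f‖² ≤ 64·10⁶ · r · (k ∫‖f‖²η + k⁻¹ ∫‖Df‖²η)`. [cite: Tao2011, §10, proof of Thm. 10.1 (pp. 32–33, (10.23))] -/
theorem setIntegral_ball_sq_norm_le_of_mem_tsupport_coreCutoff {f : EuclideanSpace ℝ (Fin 3) → F}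
    (hf : ContDiff ℝ 1 f) (hk : 0 < k) (ha : 0 < a) (hab : a + 2 * k⁻¹ < b)
    (hW : Integrable fun x => ‖f x‖ ^ 2 * annularRamp k a b ‖x - x₀‖)
    (hY : Integrable fun x => ‖fderiv ℝ f x‖ ^ 2 * annularRamp k a b ‖x - x₀‖)
    {y : EuclideanSpace ℝ (Fin 3)} (hy : y ∈ tsupport (coreCutoff x₀ k a b)) :
    ∫ x in ball y (5 * (k⁻¹ / 64)), ‖f x‖ ^ 2 ≤
      64000000 * (k⁻¹ / 64) * (k * (∫ x, ‖f x‖ ^ 2 * annularRamp k a b ‖x - x₀‖) +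
        k⁻¹ * ∫ x, ‖fderiv ℝ f x‖ ^ 2 * annularRamp k a b ‖x - x₀‖) := by
  have hab' : a + 2 / k ≤ b := by rw [div_eq_mul_inv]; exact hab.le
  have hd := annDepth_ge_of_mem_tsupport_coreCutoff hk hab' hy
  have hkinv : 0 < k⁻¹ := inv_pos.2 hk
  have hdpos : 0 < annDepth x₀ a b y := lt_of_lt_of_le (by positivity) hd
  have hmass := setIntegral_ball_sq_norm_le_whitney hf hk ha hab hdpos hW hY
  set t : ℝ := min (annDepth x₀ a b y) k⁻¹ with ht
  have ht1 : 1 / (2 * k) ≤ t := le_min hd (by rw [div_le_iff₀ (by positivity)]; nlinarith [mul_inv_cancel₀ hk.ne'])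
  have ht2 : t ≤ k⁻¹ := min_le_right _ _
  set Λ : ℝ := k * (∫ x, ‖f x‖ ^ 2 * annularRamp k a b ‖x - x₀‖) +
    k⁻¹ * ∫ x, ‖fderiv ℝ f x‖ ^ 2 * annularRamp k a b ‖x - x₀‖ with hΛ
  have hη0 : ∀ x : EuclideanSpace ℝ (Fin 3), 0 ≤ annularRamp k a b ‖x - x₀‖ := fun x =>
    annularRamp_nonneg _ _ _ _
  have hΛ0 : 0 ≤ Λ := add_nonneg (mul_nonneg hk.le (integral_nonneg fun x => mul_nonneg (sq_nonneg _)
    (hη0 x))) (mul_nonneg hkinv.le (integral_nonneg fun x => mul_nonneg (sq_nonneg _) (hη0 x)))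
  have h14 : 1 / (2 * k) = k⁻¹ / 2 := by rw [div_eq_mul_inv, mul_inv, ← div_eq_inv_mul]; ring_nf
  have hsub : ball y (5 * (k⁻¹ / 64)) ⊆ ball y (t / 4) := ball_subset_ball (by
    rw [h14] at ht1; linarith)
  calc ∫ x in ball y (5 * (k⁻¹ / 64)), ‖f x‖ ^ 2 ≤ ∫ x in ball y (t / 4), ‖f x‖ ^ 2 :=
        setIntegral_mono_set (integrableOn_of_continuous_of_isBounded (hf.continuous.norm.pow 2)
          isBounded_ball) (Eventually.of_forall fun x => sq_nonneg _) (Eventually.of_forall hsub)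
    _ ≤ 2000000 * (t / 4) * Λ := hmass
    _ ≤ 2000000 * (k⁻¹ / 4) * Λ := by gcongr
    _ ≤ 64000000 * (k⁻¹ / 64) * Λ := by nlinarith [mul_nonneg hkinv.le hΛ0]

/-- The gradient bound of the core cutoff with level `θ = 1/2` satisfies `θ ‖Dχ‖ ≤ L_ψ k`
(`L = 2k L_ψ`). [folklore] -/
theorem half_mul_coreLip_le (k : ℝ) : 1 / 2 * (2 * k * (stepLip : ℝ)) ≤ stepLip * k := by
  nlinarith

/-- The core cutoff is supported in the closed ball `B̄(x₀, b)`. [folklore] -/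
theorem tsupport_coreCutoff_subset (hk : 0 < k) (hab : a + 2 / k ≤ b) :
    tsupport (coreCutoff x₀ k a b) ⊆ closedBall x₀ b := by
  intro y hy
  have hd := annDepth_ge_of_mem_tsupport_coreCutoff hk hab hy
  have hd0 : 0 < annDepth x₀ a b y := lt_of_lt_of_le (by positivity) hd
  rw [mem_closedBall, dist_eq_norm]
  exact ((annDepth_pos_iff y).1 hd0).2.le

/-- The core cutoff has compact support. [folklore] -/
theorem hasCompactSupport_coreCutoff (hk : 0 < k) (hab : a + 2 / k ≤ b) :
    HasCompactSupport (coreCutoff x₀ k a b) :=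
  (isCompact_closedBall x₀ b).of_isClosed_subset (isClosed_tsupport _)
    (tsupport_coreCutoff_subset hk hab)

end Core

end Literature.Analysis.FluidPDE.TaoY6

end
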